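import Summits.HubbardSuperconductivity.HubbardSuperconductivity.Theses.ColourTheSpin
import Literature.MathematicalPhysics.QuantumLattice.SpinGaugedHubbardTorus
import HarnessLib

/-!
# `SgEndpoint` (stmt-HubbardSuperconductivity-16272, route `ColourTheSpin`) — negative side:
# LOAD-BEARING ANALYSIS of the crux's scalar hypotheses and the insulation normal form

The crux is, definitionally (`sgEndpoint_iff`, `Iff.rfl`),
`∀ (U δ g₀ c' L₁), 0 < U → δ ∈ (0,½) → 0 < g₀ → 0 < c' → CorridorOrderAt U δ g₀ c' L₁ → SectorLROAt U δ`: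
pointwise in `(U, δ)`, uniform gauged `B₁g` pair order `c'·L⁴·‖ψ‖²` of EVERY ground state of the
`N_L`-block of the `Q₈`-spin-gauged torus `H_g(L,U)` for all `g ∈ (0, g₀]`, even `L ≥ L₁`, implies the
summit's matrix at `(U, δ)`. This file records, as sorry-free theorems, what a disproof must contain and
which scalar side conditions carry weight (refuter cdisprove, 2026-08-17):

* `not_sgEndpoint_iff` — INSULATION NORMAL FORM: `¬ SgEndpoint ↔ ∃ (U,δ,g₀,c',L₁)` admissible with
  `CorridorOrderAt U δ g₀ c' L₁ ∧ ¬ SectorLROAt U δ`. A refutation therefore PROVES corridor order of the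
  gauged torus at some parameters (the route's open rank-0 target `SgCorridorOrder`,
  `not_not_sgEndpoint_of_not_sgCorridorOrder`) AND refutes the summit's matrix at the same `(U, δ)`
  (`exists_not_sectorLROAt_of_not_sgEndpoint`). Neither half is available at any `(U, δ)` today.
* `corridorOrderAt_of_nonpos` — for `c' ≤ 0` the corridor antecedent holds TRIVIALLY (the block of
  `P†P` is a positive form, `re_star_dotProduct_toBlock_conjTranspose_mul_self_nonneg`); hence
  `sgEndpoint_without_cpos_iff`: the crux with the side condition `0 < c'` deleted is EQUIVALENT to the
  pointwise summit matrix `∀ U > 0, ∀ δ ∈ (0,½), SectorLROAt U δ` — `0 < c'` is load-bearing (without it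
  the item asserts `d`-wave LRO of the pure Hubbard model at EVERY repulsive coupling and doping, which
  implies the summit outright).
* `sgEndpoint_without_gpos_iff` — likewise for `0 < g₀`: with `g₀ ≤ 0` admitted the `g`-range is empty,
  the antecedent vacuous, and the item is again the pointwise summit matrix.
* `corridorOrderAt_mono` / `sgEndpoint_iff_three_le` — the antecedent is monotone in `L₁`, so the crux
  is equivalent to its restriction to `L₁ ≥ 3`: the degenerate `L = 2` member of the gauged family
  (doubled bonds, excluded from the dictionary `SgHoppingDictionary`) never matters.
* `not_corridorOrderAt_of_not_sgCorridorOrder` — every statement of the shape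
  "admissible `(U,δ,g₀,c',L₁)` + `CorridorOrderAt` ⇒ `Q`" holds vacuously unless the route's target
  holds somewhere; this covers the crux and BOTH open stubs of the active skeleton `Lines/birth.lean`
  (`stub_trivialTwistSelection`, `stub_someToEveryGroundState`), which are therefore as insulated as the
  crux: their substance (twist floor, ground-eigenspace homogeneity) can be tested only in unconditional
  finite-size form (numerics in `Cruxes/SgEndpoint/Disproof.lean`).

Nothing here asserts a route statement; no item changes status. Elementary logic and positivity.
-/

namespace Summit.HubbardSuperconductivity.HubbardSuperconductivity.Theorems.SgEndpoint.Negative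

set_option linter.dupNamespace false -- summit = problem name (single-conjunct summit), D-0017
set_option linter.style.longLine false -- the route's `let`-text is kept VERBATIM (one line) so that `Iff.rfl` bridges to the item

/-! ## The crux cut into antecedent and consequent (route text VERBATIM) -/

section Verbatim

-- exactly the `open`s of the route file `Theses/ColourTheSpin.lean`, so that the text elaborates to the same term
open scoped BigOperators Topology Manifold Classical MeasureTheory ProbabilityTheory Matrix InnerProductSpace ComplexConjugate ContinuousMap
open Filter Set Function TopologicalSpace MeasureTheory
open Literature.Hubbard

/-- **The corridor antecedent of `SgEndpoint` at `(U, δ, g₀, c', L₁)`** — the route's text verbatim: for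
every `g ∈ (0, g₀]` and every even `L ≥ L₁`, every ground state `ψ` of the `N_L`-particle block of the
`Q₈`-spin-gauged torus `H_g(L,U)` has gauged `B₁g` pair order `c'·L⁴·‖ψ‖² ≤ ⟨ψ, P†P ψ⟩`
(`H = spinGaugedHubbardTorus L U g`, `P = spinGaugedPairField L` by `…_eq_inline`, `rfl`). [folklore] -/
def CorridorOrderAt (U δ g₀ c' : ℝ) (L₁ : ℕ) : Prop :=
  open Literature.MathematicalPhysics.QuantumLattice in ∀ g : ℝ, 0 < g → g ≤ g₀ → ∀ (L : ℕ) [NeZero L], L₁ ≤ L → Even L → (let m : Fin 2 × ZMod 4 → Fin 2 × ZMod 4 → Fin 2 × ZMod 4 := fun u v => (u.1 + v.1, if u.1 = 0 then (if v.1 = 0 then u.2 + v.2 else v.2 - u.2) else if v.1 = 0 then u.2 + v.2 else 2 + v.2 - u.2); let iv : Fin 2 × ZMod 4 → Fin 2 × ZMod 4 := fun u => (u.1, if u.1 = 0 then -u.2 else u.2 + 2); let r : Fin 2 × ZMod 4 → Fin 2 → Fin 2 → ℂ := fun u σ τ => if u.1 = 0 then (if σ = τ then (if σ = 0 then Complex.I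 else -Complex.I) ^ u.2.val else 0) else if σ = τ then 0 else if σ = 0 then -(-Complex.I) ^ u.2.val else Complex.I ^ u.2.val; let hop := ∑ b : GaugedHubbard.Bond L, ∑ σ : Fin 2, ∑ τ : Fin 2, Matrix.kroneckerMap (· * ·) (creation (orb b.1 σ) * annihilation (orb (b.1.shift b.2) τ)) (Matrix.diagonal fun k : GaugedHubbard.Bond L → Fin 2 × ZMod 4 => r (k b) σ τ); let H := -(hop + hopᴴ) + ((U : ℝ) : ℂ) • Matrix.kroneckerMap (· * ·) (∑ x : FermionTorus 2 L, numberOp x 0 * numberOp x 1) (1 : Matrix (GaugedHubbard.Bond L → Fin 2 × ZMod 4) (GaugedHubbard.Bond L → Fin 2 × ZMod 4) ℂ) + ((g ^ 2 : ℝ) : ℂ) • Matrix.kroneckerMap (· * ·) (1 : Matrix (Finset (Orb (FermionTorus 2 L))) _ ℂ) (∑ b : GaugedHubbard.Bond L, Matrix.of fun k k' : GaugedHubbard.Bond L → Fin 2 × ZMod 4 => if k' = Function.update k b (k' b) then (if k b = k' b then (1 : ℂ) else 0) - 1 / 8 else 0) + ((1 / g ^ 2 : ℝ) : ℂ) • Matrix.kroneckerMap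 (· * ·) (1 : Matrix (Finset (Orb (FermionTorus 2 L))) _ ℂ) (Matrix.diagonal fun k : GaugedHubbard.Bond L → Fin 2 × ZMod 4 => ∑ x : FermionTorus 2 L, (1 - (r (m (m (m (k (x, 0)) (k (x.shift 0, 1))) (iv (k (x.shift 1, 0)))) (iv (k (x, 1)))) 0 0 + r (m (m (m (k (x, 0)) (k (x.shift 0, 1))) (iv (k (x.shift 1, 0)))) (iv (k (x, 1)))) 1 1) / 2)); let P := ∑ b : GaugedHubbard.Bond L, (if b.2 = 0 then (1 : ℂ) else -1) • ∑ σ : Fin 2, ∑ τ : Fin 2, Matrix.kroneckerMap (· * ·) (annihilation (orb b.1 σ) * annihilation (orb (b.1.shift b.2) τ)) (Matrix.diagonal fun k : GaugedHubbard.Bond L → Fin 2 × ZMod 4 => if σ = 0 then r (k b) 1 τ else -r (k b) 0 τ); let p := fun ik : Finset (Orb (FermionTorus 2 L)) × (GaugedHubbard.Bond L → Fin 2 × ZMod 4) => ik.1.card = 2 * ⌊(1 - δ) * (L : ℝ) ^ 2 / 2⌋₊; ∀ ψ : {ik // p ik} → ℂ, (ψ ≠ 0 ∧ ∃ E : ℝ,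 H.toBlock p p *ᵥ ψ = (E : ℂ) • ψ ∧ ∀ φ : {ik // p ik} → ℂ, E * (star φ ⬝ᵥ φ).re ≤ (star φ ⬝ᵥ H.toBlock p p *ᵥ φ).re) → c' * (L : ℝ) ^ 4 * (star ψ ⬝ᵥ ψ).re ≤ (star ψ ⬝ᵥ (Pᴴ * P).toBlock p p *ᵥ ψ).re)

/-- **The consequent of `SgEndpoint` at `(U, δ)`** — the summit's matrix verbatim (the two leading
existentials of `Literature.Hubbard.DWaveSuperconductivityHubbard` stripped). [folklore] -/
def SectorLROAt (U δ : ℝ) : Prop :=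
  open Literature.MathematicalPhysics.QuantumLattice in ∀ (N : ℕ → ℕ) (ψ : ∀ L, Fock (Orb (FermionTorus 2 L))), (∀ L, Even L → N L = 2 * ⌊(1 - δ) * (L : ℝ) ^ 2 / 2⌋₊ ∧ star (ψ L) ⬝ᵥ ψ L = 1 ∧ IsGroundStateInSector (hubbardTorus 2 L 1 U) (N L) 0 (ψ L)) → Literature.Probability.LatticeModels.HasLongRangeOrder (fun k => Literature.Probability.LatticeModels.halfOpenBox 2 (2 * k)) (fun k => torusPullback (pairFieldCorr dWaveFormFactor ψ) (2 * k))

/-- The crux BY NAME is definitionally "antecedent → consequent, pointwise in `(U, δ)`". [folklore] -/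
theorem sgEndpoint_iff :
    Summit.HubbardSuperconductivity.HubbardSuperconductivity.Theses.ColourTheSpin.SgEndpoint ↔
      ∀ (U δ g₀ c' : ℝ) (L₁ : ℕ), 0 < U → δ ∈ Set.Ioo (0 : ℝ) (1 / 2) → 0 < g₀ → 0 < c' →
        CorridorOrderAt U δ g₀ c' L₁ → SectorLROAt U δ :=
  Iff.rfl

/-- The route's rank-0 TARGET by name is definitionally "corridor order at SOME admissible parameters".
[folklore] -/
theorem sgCorridorOrder_iff :
    Summit.HubbardSuperconductivity.HubbardSuperconductivity.Theses.ColourTheSpin.SgCorridorOrder ↔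
      ∃ U : ℝ, 0 < U ∧ ∃ δ ∈ Set.Ioo (0 : ℝ) (1 / 2), ∃ g₀ : ℝ, 0 < g₀ ∧ ∃ c' : ℝ, 0 < c' ∧
        ∃ L₁ : ℕ, CorridorOrderAt U δ g₀ c' L₁ :=
  Iff.rfl

end Verbatim

open Matrix

/-! ## Insulation: the shape of any disproof -/

/-- **Insulation normal form.** `¬ SgEndpoint` is EQUIVALENT to the existence of admissible
`(U, δ, g₀, c', L₁)` at which the corridor antecedent HOLDS and the summit's matrix FAILS. [folklore] -/
theorem not_sgEndpoint_iff :
    ¬ Summit.HubbardSuperconductivity.HubbardSuperconductivity.Theses.ColourTheSpin.SgEndpoint ↔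
      ∃ (U δ g₀ c' : ℝ) (L₁ : ℕ), 0 < U ∧ δ ∈ Set.Ioo (0 : ℝ) (1 / 2) ∧ 0 < g₀ ∧ 0 < c' ∧
        CorridorOrderAt U δ g₀ c' L₁ ∧ ¬ SectorLROAt U δ := by
  rw [sgEndpoint_iff]
  push Not
  rfl

/-- **A disproof proves the route's target** (negative form): if corridor order holds NOWHERE (the
route's rank-0 target `SgCorridorOrder` fails), the crux cannot fail. Equivalently `¬ SgEndpoint →
SgCorridorOrder` (landed positively as `sgEndpoint_of_not_sgCorridorOrder` in
`Theorems/ColourTheSpinSgEndpointStubBornOppenheimerFlatLimit.lean`): the witness parameters of any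
refutation carry corridor order of the gauged torus. [folklore] -/
theorem not_not_sgEndpoint_of_not_sgCorridorOrder
    (h : ¬ Summit.HubbardSuperconductivity.HubbardSuperconductivity.Theses.ColourTheSpin.SgCorridorOrder) :
    ¬ ¬ Summit.HubbardSuperconductivity.HubbardSuperconductivity.Theses.ColourTheSpin.SgEndpoint := by
  intro hE
  obtain ⟨U, δ, g₀, c', L₁, hU, hδ, hg, hc, hC, -⟩ := not_sgEndpoint_iff.1 hE
  exact h (sgCorridorOrder_iff.2 ⟨U, hU, δ, hδ, g₀, hg, c', hc, L₁, hC⟩)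

/-- **A disproof refutes the summit's matrix at a point.** `¬ SgEndpoint` yields admissible `(U, δ)` at
which some normalised `(N_L, S^z = 0)`-sector ground-state sequence of `hubbardTorus 2 L 1 U` has NO
`d_{x²-y²}` pair-field long-range order — a rigorous no-go for the pure Hubbard model at a repulsive
coupling and a doping in `(0, ½)`, unavailable at any such point today. [folklore] -/
theorem exists_not_sectorLROAt_of_not_sgEndpoint
    (h : ¬ Summit.HubbardSuperconductivity.HubbardSuperconductivity.Theses.ColourTheSpin.SgEndpoint) :
    ∃ (U δ : ℝ), 0 < U ∧ δ ∈ Set.Ioo (0 : ℝ) (1 / 2) ∧ ¬ SectorLROAt U δ := by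
  obtain ⟨U, δ, g₀, c', L₁, hU, hδ, -, -, -, hS⟩ := not_sgEndpoint_iff.1 h
  exact ⟨U, δ, hU, hδ, hS⟩

/-- **Every corridor-conditional statement is insulated by the target.** If the route's target fails
(corridor order nowhere), then the corridor antecedent is FALSE at every admissible parameter, so ANY
statement of the shape "admissible parameters + corridor antecedent ⇒ `Q`" holds vacuously — the crux
(`Q :=` the summit matrix) and both open stubs of `Lines/birth.lean` (`stub_trivialTwistSelection`:
`Q :=` eventual pure-gauge minimisers; `stub_someToEveryGroundState`: `Q :=` some ⇒ every ground-state
order) included: none of them can be refuted before the target is proved somewhere. [folklore] -/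
theorem not_corridorOrderAt_of_not_sgCorridorOrder
    (h : ¬ Summit.HubbardSuperconductivity.HubbardSuperconductivity.Theses.ColourTheSpin.SgCorridorOrder)
    {U δ g₀ c' : ℝ} (L₁ : ℕ) (hU : 0 < U) (hδ : δ ∈ Set.Ioo (0 : ℝ) (1 / 2)) (hg : 0 < g₀)
    (hc : 0 < c') : ¬ CorridorOrderAt U δ g₀ c' L₁ :=
  fun hC => h (sgCorridorOrder_iff.2 ⟨U, hU, δ, hδ, g₀, hg, c', hc, L₁, hC⟩)

/-! ## `0 < g₀` is load-bearing: without it the `g`-range may be empty -/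

/-- With `g₀ ≤ 0` the corridor antecedent is VACUOUSLY true (no `g` with `0 < g ≤ g₀`). [folklore] -/
theorem corridorOrderAt_of_nonpos_g₀ {U δ g₀ c' : ℝ} {L₁ : ℕ} (hg : g₀ ≤ 0) :
    CorridorOrderAt U δ g₀ c' L₁ := by
  intro g hg0 hgg
  exact absurd (hg0.trans_le (hgg.trans hg)) (lt_irrefl 0)

/-- **`0 < g₀` deleted ⇒ the crux becomes the pointwise summit matrix** `∀ U > 0, ∀ δ ∈ (0,½),
SectorLROAt U δ` (a statement implying the summit at once and asserting `d`-wave LRO of the pure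
Hubbard model at EVERY repulsive coupling and doping). So the side condition `0 < g₀` is load-bearing:
it is what keeps the `g`-range of the antecedent non-empty. [folklore] -/
theorem sgEndpoint_without_gpos_iff :
    (∀ (U δ g₀ c' : ℝ) (L₁ : ℕ), 0 < U → δ ∈ Set.Ioo (0 : ℝ) (1 / 2) → 0 < c' →
        CorridorOrderAt U δ g₀ c' L₁ → SectorLROAt U δ) ↔
      ∀ (U δ : ℝ), 0 < U → δ ∈ Set.Ioo (0 : ℝ) (1 / 2) → SectorLROAt U δ := by
  constructor
  · intro h U δ hU hδ
    exact h U δ 0 1 0 hU hδ one_pos (corridorOrderAt_of_nonpos_g₀ le_rfl)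
  · intro h U δ _ _ _ hU hδ _ _
    exact h U δ hU hδ

/-! ## `0 < c'` is load-bearing: the block of `P†P` is a positive form -/

open scoped ComplexOrder in
/-- **Positivity of the compressed square.** For every matrix `M` and every predicate `p` on its index
type, the `p`-block of `Mᴴ * M` is a positive form: `0 ≤ Re ⟨ψ, (Mᴴ M)_{pp} ψ⟩` (a principal submatrix
of the positive semidefinite `Mᴴ M`). Stated for an ARBITRARY decidability instance of `p`, so that it
applies to the route's inlined `let`-block verbatim. [folklore] -/
theorem re_star_dotProduct_toBlock_conjTranspose_mul_self_nonneg {n : Type*} [Fintype n]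
    (M : Matrix n n ℂ) (p : n → Prop) [DecidablePred p] (ψ : {a // p a} → ℂ) :
    0 ≤ (star ψ ⬝ᵥ (Mᴴ * M).toBlock p p *ᵥ ψ).re := by
  have h1 : (Mᴴ * M).PosSemidef := Matrix.posSemidef_conjTranspose_mul_self M
  have h2 : ((Mᴴ * M).toBlock p p).PosSemidef := h1.submatrix _
  simpa using h2.re_dotProduct_nonneg ψ

open scoped ComplexOrder in
/-- `0 ≤ Re ⟨ψ, ψ⟩`. [folklore] -/
theorem re_star_dotProduct_self_nonneg {ι : Type*} [Fintype ι] (ψ : ι → ℂ) :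
    0 ≤ (star ψ ⬝ᵥ ψ).re :=
  (Complex.nonneg_iff.1 (dotProduct_star_self_nonneg ψ)).1

section NonPos

-- the route file's `open`s again: the antecedent is unfolded below and must elaborate identically
open scoped BigOperators Topology Manifold Classical MeasureTheory ProbabilityTheory Matrix InnerProductSpace ComplexConjugate ContinuousMap
open Filter Set Function TopologicalSpace MeasureTheory
open Literature.Hubbard Literature.MathematicalPhysics.QuantumLattice

/-- **With `c' ≤ 0` the corridor antecedent holds TRIVIALLY**: its conclusion
`c'·L⁴·‖ψ‖² ≤ Re⟨ψ, (P†P)_{block} ψ⟩` has a non-positive left side and a non-negative right side, for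
EVERY vector `ψ` (ground state or not), every `g`, every `L`. So the sign condition `0 < c'` is exactly
what makes the antecedent of `SgEndpoint` a genuine order hypothesis. [folklore] -/
theorem corridorOrderAt_of_nonpos {U δ g₀ c' : ℝ} {L₁ : ℕ} (hc : c' ≤ 0) :
    CorridorOrderAt U δ g₀ c' L₁ := by
  intro g _ _ L _ _ _ m iv r hop H P p ψ _
  have hL : c' * (L : ℝ) ^ 4 * (star ψ ⬝ᵥ ψ).re ≤ 0 :=
    mul_nonpos_iff.2 (Or.inr ⟨mul_nonpos_iff.2 (Or.inr ⟨hc, by positivity⟩),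
      re_star_dotProduct_self_nonneg ψ⟩)
  exact hL.trans (re_star_dotProduct_toBlock_conjTranspose_mul_self_nonneg P p ψ)

end NonPos

/-- **`0 < c'` deleted ⇒ the crux becomes the pointwise summit matrix** (`→`: instantiate the
deleted variant at `c' = 0`, where the antecedent is free by `corridorOrderAt_of_nonpos`; `←`: the
consequent does not depend on the antecedent). So `0 < c'` is load-bearing in the same sense as
`0 < g₀`. [folklore] -/
theorem sgEndpoint_without_cpos_iff :
    (∀ (U δ g₀ c' : ℝ) (L₁ : ℕ), 0 < U → δ ∈ Set.Ioo (0 : ℝ) (1 / 2) → 0 < g₀ →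
        CorridorOrderAt U δ g₀ c' L₁ → SectorLROAt U δ) ↔
      ∀ (U δ : ℝ), 0 < U → δ ∈ Set.Ioo (0 : ℝ) (1 / 2) → SectorLROAt U δ := by
  constructor
  · intro h U δ hU hδ
    exact h U δ 1 0 0 hU hδ one_pos (corridorOrderAt_of_nonpos le_rfl)
  · intro h U δ _ _ _ hU hδ _ _
    exact h U δ hU hδ

/-! ## Monotonicity: the crux may assume `L₁ ≥ 3` -/

/-- The corridor antecedent is MONOTONE in the side threshold: order from `L₁` on gives order from any
`L₁' ≥ L₁` on. [folklore] -/
theorem corridorOrderAt_mono {U δ g₀ c' : ℝ} {L₁ L₁' : ℕ} (hL : L₁ ≤ L₁')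
    (h : CorridorOrderAt U δ g₀ c' L₁) : CorridorOrderAt U δ g₀ c' L₁' :=
  fun g hg hgg L _ hL' hE => h g hg hgg L (hL.trans hL') hE

/-- The corridor antecedent is ANTITONE in `g₀`: order on `(0, g₀]` gives order on `(0, g₀']` for
`g₀' ≤ g₀`. [folklore] -/
theorem corridorOrderAt_anti_g₀ {U δ g₀ g₀' c' : ℝ} {L₁ : ℕ} (hg : g₀' ≤ g₀)
    (h : CorridorOrderAt U δ g₀ c' L₁) : CorridorOrderAt U δ g₀' c' L₁ :=
  fun g hg0 hgg L _ hL hE => h g hg0 (hgg.trans hg) L hL hE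

/-- **The crux is equivalent to its restriction to `L₁ ≥ 3`.** (`←`: given the antecedent from `L₁`,
it holds from `max L₁ 3` by monotonicity, and the restricted crux applies.) So the degenerate `L = 2`
member of the gauged family — doubled bonds, excluded from `SgHoppingDictionary` — is never needed, and
every use of the antecedent may assume `3 ≤ L`, where the frozen trivial-link block IS
`hubbardTorus 2 L 1 U` (`spinGaugedHubbardTorus_apply_one_one`). [folklore] -/
theorem sgEndpoint_iff_three_le :
    Summit.HubbardSuperconductivity.HubbardSuperconductivity.Theses.ColourTheSpin.SgEndpoint ↔
      ∀ (U δ g₀ c' : ℝ) (L₁ : ℕ), 3 ≤ L₁ → 0 < U → δ ∈ Set.Ioo (0 : ℝ) (1 / 2) → 0 < g₀ → 0 < c' →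
        CorridorOrderAt U δ g₀ c' L₁ → SectorLROAt U δ := by
  rw [sgEndpoint_iff]
  constructor
  · intro h U δ g₀ c' L₁ _ hU hδ hg hc hC
    exact h U δ g₀ c' L₁ hU hδ hg hc hC
  · intro h U δ g₀ c' L₁ hU hδ hg hc hC
    exact h U δ g₀ c' (max L₁ 3) (le_max_right _ _) hU hδ hg hc
      (corridorOrderAt_mono (le_max_left _ _) hC)

end Summit.HubbardSuperconductivity.HubbardSuperconductivity.Theorems.SgEndpoint.Negative
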